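import Mathlib
import HarnessLib
import Summits.NavierStokesRegularity.NavierStokesRegularity.Theses.PoloidalWindowDoor
import Summits.NavierStokesRegularity.NavierStokesRegularity.Theorems.PoloidalWindowDoorPoloidalWindowRigiditySharper
import Summits.NavierStokesRegularity.NavierStokesRegularity.Theorems.PoloidalWindowDoorPoloidalWindowRigidityK2OfLrcSpatial
import Summits.NavierStokesRegularity.NavierStokesRegularity.Theorems.PoloidalWindowDoorPoloidalWindowRigidityHorizontalFlatPast
import Summits.NavierStokesRegularity.NavierStokesRegularity.Theorems.PoloidalWindowDoorPoloidalWindowRigidityTimeShearLiminf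
import Summits.NavierStokesRegularity.NavierStokesRegularity.Theorems.PoloidalWindowDoorPoloidalWindowRigidityStubUntwisted
import Summits.NavierStokesRegularity.NavierStokesRegularity.Theorems.PoloidalWindowDoorPoloidalWindowRigidityThmAThreeStubs
import Summits.NavierStokesRegularity.NavierStokesRegularity.Theorems.PoloidalWindowDoorPoloidalWindowRigidityThmARelocation
import Summits.NavierStokesRegularity.NavierStokesRegularity.Theorems.PoloidalWindowDoorPoloidalWindowRigidityRieszCollapse
import Summits.NavierStokesRegularity.NavierStokesRegularity.Theorems.PoloidalWindowDoorPoloidalWindowRigidityPairingCollapse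
import Summits.NavierStokesRegularity.NavierStokesRegularity.Theorems.PoloidalWindowDoorPoloidalWindowRigidityBalanceDatum


/-!
# Line `sonic_cut` — crux `PoloidalWindowRigidity` (K2, stmt-NavierStokesRegularity-19708), hyperbolic THICK column (cell `hHT`):
# the PAIRING `Q₃ = ⟨∂₂v, ∇v₂⟩ = I + (∂₂v₂)²` is a NULL LAGRANGIAN of the large-scale calculus (`Q₃ = ∂ᵢ∂ⱼB³ᵢⱼ(v)`), so by the class ENERGY LEVEL it
# cannot keep a sign on a slice unless it vanishes; sign-kept (subsonic or supersonic) slabs are therefore SELF-CHARACTERISTIC (simple waves: eikonal + K1), a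
# strictly smaller deciding cell; the residue is the TRANSONIC-dense thick window

IDEATOR seat ns-idea-8 (generation g4, second line), lens «barrier»: the N0 THICK column of LADDER-NS, cell `hHT` of `…ThmAThreeStubs.twisting_regular_of_three`
(twisting THICK windows with `I := ∂₂v₀∂₀v₂ + ∂₂v₁∂₁v₂ < 0`).  Registered attacks on this cell: `z_shock` (height-as-time genuine nonlinearity ⇒ shock; needs
the characteristic family / entropy datum), `mixed_type` (DGNM pockets), `far_thread` / `thread_axis` (thread geometry), cstrat censuses.  LINE 8 of this seat
(`riesz_collapse`) emptied the SEMI-ELLIPTIC cell with the null Lagrangian `−Δp = ∂ᵢ∂ⱼ(vᵢvⱼ)`; the present line asks what the SAME CALCULUS says on the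
hyperbolic side, where `−Δp` is unsigned.

THE LEVER.  CLASSIFICATION (exact linear algebra over ℚ, ns-idea-8 g4, reproducible script in the line card): for poloidal divergence-free fields the quadratic
symmetric tensors `B(v)` whose double divergence `∂ᵢ∂ⱼBᵢⱼ` is a form in FIRST derivatives span, modulo trivial syzygies, exactly THREE null Lagrangians:
`det ∇_h v_h` (`B¹`, horizontal slots only — hence even LAYER-wise collapsible), the PAIRING `Q₃ = ⟨∂₂v,∇v₂⟩ = I + (∂₂v₂)²` (`B³`), and the WEDGE
`∂₂v₁∂₀v₂ − ∂₂v₀∂₁v₂` (`B²`; it vanishes identically under the frozen law — the frozen law is a double conservation law).  (`−Δp = 2Q₃ − 2det ∇_h v_h` is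
their combination; NO combination is automatically signed on a hyperbolic slice — which is why the hyperbolic columns need wave-type tools, recorded.)  Each
null Lagrangian COLLAPSES on every slice at rate `R^{−1/2}(−s)^{−1/4}` by two integrations by parts into the Hessian collar of the cut-off and the class
energy level `α = 3/2` (`…LargeScaleEnergyBootstrapUniform.exists_uniform_level_of_gt_one`, KERNEL).  The SIGNED instance available on the hyperbolic side is
the pairing: `Q₃ ≥ 0` everywhere (SUBSONIC slice: the hyperbolic defect `|I|` never exceeds the vertical stretching `(∂₂v₂)²`) or `Q₃ ≤ 0` everywhere
(SUPERSONIC slice) forces `Q₃ ≡ 0` — STUB T1 `stub_pairingCollapse` (provable, M).  A pairing-null slice satisfies, with the frozen law, the EIKONAL relation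
`m|∇_h w|² + w_z² = 0` (`w = v₂`): the level surfaces of `w` are characteristic for its own height-evolution `K1` — `w` is a SIMPLE WAVE.  That is precisely the
entry datum (`which characteristic family`) that the `z_shock` programme must otherwise produce; with it, THICK (= genuinely nonlinear, `m_w ≠ 0`) simple waves
break in finite height and cannot be entire in `z`, while linearly degenerate ones are (TV)/(TH) — STUB T2 `stub_selfCharacteristic` (research-grade but
strictly inside `hHT`, with a machine route: finite-jet prolongation of the overdetermined pair).  The RESIDUE is named, not hidden: STUB T3 `stub_transonicThick`
— thick hyperbolic windows near which TRANSONIC slices (both a strict subsonic and a strict supersonic point) are dense in time.  The SONIC CUT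
`hHT = (sign-kept slab: T1 ⊢ T2) ∪ (transonic-dense: T3)` is kernel-checked here (`hyperbolicThick_of_sonicCut`, pure logic + heredity of the window clauses).

(M) IS CONSUMED at T1 (energy level; the bounded (TH)-hyperbolic kinematic solutions — superposed plane waves — violate the level) — `hyperbolicThick_false_without_mild`
honoured; T2 consumes the frozen law (Clebsch, (M)) and K1.  STUBS: T1 (provable M), T2 (M/L, deciding, smaller than `hHT`), T3 (residue, open), shared R1
`stub_rieszCollapse` VERBATIM from `Lines/riesz_collapse.lean` (gives `hST`, proof copied) and shared `stub_hyperbolicTH` VERBATIM ((TH) column).  Composition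
`PoloidalWindowRigidity_of_sonicCut : …Theses.PoloidalWindowDoor.PoloidalWindowRigidity` kernel-checked over `twisting_regular_of_three`, `stub_untwisted`,
`nonflatLiouville_of_lrc_spatial`, `poloidalWindowRigidity_of_sliceSharpNonflatLiouville`.  `lean check`: rc 0, sorries = 6 = stubs (v2/v3); v4 (ns-idea-8 g6, housekeeping per idea-crit-7 g3 18:18:39Z): R1 `stub_rieszCollapse` (p650966), T1 `stub_pairingCollapse` (p653700), B1 `stub_balanceDatum` (p656190) are LANDED tree theorems and are DISCHARGED BY NAME here (imports `…RieszCollapse`, `…PairingCollapse`, `…BalanceDatum`); sorries = 3 = {`stub_hyperbolicTH` (shared (TH)), T2 `stub_selfCharacteristic`, T3 `stub_transonicThick`}.  No summit is proved.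
v2 (2026-08-28, prices of idea-crit-7 g3 16:17:59Z): P9-3 — new PROVABLE stub B1 `stub_balanceDatum` (the three null-Lagrangian weighted masses
`|∫χQ₃|, |∫χ det∇ₕvₕ|, |∫χ e|` are `≤ K′R^{−1/2}(−s)^{−1/4}` at every centre/scale, from T1's calculus + the class energy level) and T3 now CARRIES that
datum as a typed hypothesis, fed by B1 in `hyperbolicThick_of_sonicCut`; P9-2 — T2's CHEAPEST FALSIFIER is the exact-algebra cell
`Lines/sonic_cut_T2_cellspec.md` (jet prolongation of {DIV, POL, frozen law, K1, eikonal, (E∇)}; word EMPTY-JET-LOCUS(k)/NON-EMPTY(k)) filed to ARM C.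

NOVELTY vs listed lines/routes: no registered line or tree theorem uses a null-Lagrangian/collapse identity on the HYPERBOLIC side, none has the subsonic · supersonic ·
transonic trichotomy of slices, and none supplies `z_shock`'s characteristic-family datum from a class theorem; nearest: `riesz_collapse` (same calculus,
semi-elliptic sign — this line's T1 is its hyperbolic-side sibling, and the CUT T2/T3 is new), `z_shock` (consumes what T1 ⊢ eikonal produces).  BARRIERS:
technique_class = null-Lagrangian collapse + energy level (T1) · simple-wave breakdown / finite-jet elimination (T2); not a symmetry reduction, not a local
(M)-free jet statement (T1 carries the class binders; T2 carries K1 + frozen law + eikonal), polynomial sector untouched (Theorem P), no self-similar object,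
Liouville wall not met.  INSTRUMENT ROW (would refute T1): a class profile with a slice on which `I + (∂₂v₂)²` keeps a sign and is not `≡ 0` — impossible by the
argument above short of a formalisation gap; (would refute T2): an (M)-compatible thick twisting self-characteristic germ surviving prolongation to order 4 —
the cheapest falsifier, a CERT job.  HONESTY: no summit is proved; the crux is NOT proved; `hHT` is RE-CUT, not closed: T2 and T3 remain open (T3 is the
honest core).  bears_on: LADDER-NS N0 (crux 19708), cell `hHT`.
-/

noncomputable section

set_option linter.dupNamespace false
set_option linter.unusedVariables false

namespace Summit.NavierStokesRegularity.NavierStokesRegularity.Cruxes.PoloidalWindowRigidity.SonicCut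

open Set Function Metric MeasureTheory
open scoped RealInnerProductSpace InnerProductSpace Topology
open Literature.Analysis Literature.Analysis.FluidPDE
open Summit.NavierStokesRegularity.NavierStokesRegularity.Theorems.PoloidalWindowDoorPoloidalWindowRigiditySharper
open Summit.NavierStokesRegularity.NavierStokesRegularity.Theorems.PoloidalWindowDoorPoloidalWindowRigidityK2OfLrcSpatial
open Summit.NavierStokesRegularity.NavierStokesRegularity.Theorems.PoloidalWindowDoorPoloidalWindowRigidityHorizontalFlatPast
open Summit.NavierStokesRegularity.NavierStokesRegularity.Theorems.PoloidalWindowDoorPoloidalWindowRigidityThmAThreeStubs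
open Summit.NavierStokesRegularity.NavierStokesRegularity.Theorems.PoloidalWindowDoorPoloidalWindowRigidityThmARelocation

/-! ### Shared stubs (other columns; restated VERBATIM so that the composition is self-contained) -/

/-- **STUB (`stub_hyperbolicTH`) — SHARED VERBATIM with `Lines/mixed_type.lean` / `z_shock.lean` (`hH` of `twisting_regular_of_three`): hyperbolic
(TH) twisting windows are regular.**  Lines of record: string_shells (proved there from its own stubs), entire_slices.  Not re-cut here.
Why it might fail: as recorded there (`twistingTH_false_without_mild`: (M) load-bearing). -/
theorem stub_hyperbolicTH :
    ∀ (C : ℝ) (v : ℝ → EuclideanSpace ℝ (Fin 3) → EuclideanSpace ℝ (Fin 3)),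
      Literature.Analysis.FluidPDE.HasTypeITimeDecay C v →
      ContinuousOn (Function.uncurry v) (Set.Iio (0 : ℝ) ×ˢ Set.univ) →
      (∀ s t : ℝ, s < t → t < 0 → ∀ x, v t x =
        Literature.Analysis.UnboundedOperators.heatExtension (v s) (t - s) x -
          Literature.Analysis.FluidPDE.oseenDuhamel 1 s v v t x) →
      (∀ t < 0, Literature.Analysis.FluidPDE.VectorCalculus.IsDivFree (v t)) →
      (∀ s < 0, ∀ y, ⟪Literature.Analysis.FluidPDE.curl (v s) y, EuclideanSpace.single 2 1⟫_ℝ = 0) →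
      ∀ W : Set (ℝ × EuclideanSpace ℝ (Fin 3)), IsOpen W → W.Nonempty → W ⊆ Set.Iio (0 : ℝ) ×ˢ Set.univ →
        (∀ z ∈ W, Literature.Analysis.FluidPDE.curl (v z.1) z.2 ≠ 0 ∧
          (fderiv ℝ (v z.1) z.2 (EuclideanSpace.single 0 1) 2 ≠ 0 ∨ fderiv ℝ (v z.1) z.2 (EuclideanSpace.single 1 1) 2 ≠ 0) ∧
          (fderiv ℝ (v z.1) z.2 (EuclideanSpace.single 2 1) 0 ≠ 0 ∨ fderiv ℝ (v z.1) z.2 (EuclideanSpace.single 2 1) 1 ≠ 0)) →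
        (∀ m : ℝ → ℝ, ∀ W₁ : Set (ℝ × EuclideanSpace ℝ (Fin 3)), W₁ ⊆ W → IsOpen W₁ → W₁.Nonempty →
          ∃ z ∈ W₁, ∃ b : Fin 3, b ≠ 2 ∧
            fderiv ℝ (v z.1) z.2 (EuclideanSpace.single 2 1) b ≠
              m z.1 * fderiv ℝ (v z.1) z.2 (EuclideanSpace.single b 1) 2) →
        (∀ z ∈ W,
          fderiv ℝ (fun x => fderiv ℝ (v z.1) x (EuclideanSpace.single 2 1) 2) z.2 (EuclideanSpace.single 0 1) *
              fderiv ℝ (v z.1) z.2 (EuclideanSpace.single 1 1) 2 -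
            fderiv ℝ (fun x => fderiv ℝ (v z.1) x (EuclideanSpace.single 2 1) 2) z.2 (EuclideanSpace.single 1 1) *
              fderiv ℝ (v z.1) z.2 (EuclideanSpace.single 0 1) 2 ≠ 0) →
        (∀ z ∈ W,
          fderiv ℝ (v z.1) z.2 (EuclideanSpace.single 2 1) 0 * fderiv ℝ (v z.1) z.2 (EuclideanSpace.single 0 1) 2 +
            fderiv ℝ (v z.1) z.2 (EuclideanSpace.single 2 1) 1 * fderiv ℝ (v z.1) z.2 (EuclideanSpace.single 1 1) 2 < 0) →
        (∃ m : ℝ → ℝ → ℝ, ∀ z ∈ W, ∀ b : Fin 3, b ≠ 2 →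
          fderiv ℝ (v z.1) z.2 (EuclideanSpace.single 2 1) b =
            m z.1 (z.2 2) * fderiv ℝ (v z.1) z.2 (EuclideanSpace.single b 1) 2) →
        ¬ Literature.Analysis.FluidPDE.IsBackwardSingularPoint v 0 := by

  sorry

/-! ### This line's stubs (hyperbolic THICK column `hHT`): the SONIC CUT -/

/-- **STUB T1 (`stub_pairingCollapse`) — THE LEVER, provable (M-sized): on a slice `s < 0` of a class profile, poloidal along `e₃`, the PAIRING
`Q₃ := ⟨∂₂v, ∇v₂⟩ = ∂₂v₀∂₀v₂ + ∂₂v₁∂₁v₂ + (∂₂v₂)² = I + (∂₂v₂)²` cannot keep a sign unless it vanishes identically.**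
PROOF ROUTE (all ingredients in the tree; same calculus as `Lines/riesz_collapse.lean` R1 with a different null Lagrangian).  (i) EXACT IDENTITY (poloidal,
divergence-free, `C²`; verified by exact polynomial algebra, ns-idea-8 g4): `Q₃ = ∂ᵢ∂ⱼB³ᵢⱼ(v)` with the quadratic symmetric tensor
`B³ = [[½(v₀²−v₁²), v₀v₁, ½v₀v₂],[v₀v₁, ½(v₁²−v₀²), ½v₁v₂],[½v₀v₂, ½v₁v₂, ½v₂²]]` (`|B³| ≤ |v|²`).  (ii) Against the smooth cut-off
`χ_R(y) = smoothTransition(2 − ‖y‖²/R²)` (`= 1` on `B̄_R`, support `⊆ B̄_{2R}`, `‖D²χ_R‖ ≤ c/R²`: `…EnstrophyHessianCollar.exists_norm_iteratedFDeriv_two_smoothTransition_cutoff_le`),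
two integrations by parts without boundary: `∫ χ_R Q₃(s) = ∫ B³ : D²χ_R`, so `|∫ χ_R Q₃(s)| ≤ (9c/R²)∫_{B̄(0,2R)}‖v(s)‖²`.  (iii) ENERGY LEVEL
`…LargeScaleEnergyBootstrapUniform.exists_uniform_level_of_gt_one` (KERNEL), `α = 3/2`: `∫_{B̄(0,2R)}‖v(s)‖² ≤ K(2R)^{3/2}(−s)^{−1/4}`, hence
`|∫ χ_R Q₃(s)| ≤ 9cK2^{3/2}R^{−1/2}(−s)^{−1/4} → 0`.  (iv) If `Q₃(s,·)` keeps a sign, `R ↦ |∫_{B_R}Q₃(s)|` is non-decreasing and `≤ |∫χ_R Q₃(s)| → 0`, so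
`∫_{B_r}Q₃(s) = 0` for every `r`; continuity and the sign give `Q₃(s,·) ≡ 0`.  (M) consumed through the level (the bounded (TH)-hyperbolic kinematic solutions —
superposed plane waves `Ψ = Σ cos(kⱼ·x_h ± |kⱼ|z)` — have `∫_{B_R}|v|² ≍ R³` and are not in the class): `hyperbolicThick_false_without_mild` honoured HERE.
MEANING: `Q₃ ≥ 0` = SUBSONIC (`|I| ≤ (∂₂v₂)²` where hyperbolic), `Q₃ ≤ 0` everywhere = everywhere SUPERSONIC; either way the slice is PAIRING-NULL:
`∂₂v ⊥ ∇v₂` pointwise, i.e. with the frozen law `m|∇_h v₂|² + (∂₂v₂)² = 0` — the graph of `v₂` is CHARACTERISTIC for its own height-evolution `K1`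
(`∂₂₂v₂ + div_h(m∇_h v₂) = 0`, symbol `ξ₂² + m|ξ_h|²`): a SIMPLE WAVE.
Why it might fail: only the formalisation (cut-off Hessian bookkeeping in `EuclideanSpace ℝ (Fin 3)` coordinates; integrability side conditions of the two
integrations by parts; `∫_{B_r}Q₃ = 0 ∧ Q₃` signed continuous ⇒ `Q₃ = 0`). -/
theorem stub_pairingCollapse :
    ∀ (C : ℝ) (v : ℝ → EuclideanSpace ℝ (Fin 3) → EuclideanSpace ℝ (Fin 3)),
      Literature.Analysis.FluidPDE.HasTypeITimeDecay C v →
      ContinuousOn (Function.uncurry v) (Set.Iio (0 : ℝ) ×ˢ Set.univ) →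
      (∀ s t : ℝ, s < t → t < 0 → ∀ x, v t x =
        Literature.Analysis.UnboundedOperators.heatExtension (v s) (t - s) x -
          Literature.Analysis.FluidPDE.oseenDuhamel 1 s v v t x) →
      (∀ t < 0, Literature.Analysis.FluidPDE.VectorCalculus.IsDivFree (v t)) →
      (∀ s < 0, ∀ y, ⟪Literature.Analysis.FluidPDE.curl (v s) y, EuclideanSpace.single 2 1⟫_ℝ = 0) →
      ∀ s : ℝ, s < 0 →
        ((∀ y : EuclideanSpace ℝ (Fin 3), 0 ≤ fderiv ℝ (v s) y (EuclideanSpace.single 2 1) 0 * fderiv ℝ (v s) y (EuclideanSpace.single 0 1) 2 + fderiv ℝ (v s) y (EuclideanSpace.single 2 1) 1 * fderiv ℝ (v s) y (EuclideanSpace.single 1 1) 2 + fderiv ℝ (v s) y (EuclideanSpace.single 2 1) 2 ^ 2) ∨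
          (∀ y : EuclideanSpace ℝ (Fin 3), fderiv ℝ (v s) y (EuclideanSpace.single 2 1) 0 * fderiv ℝ (v s) y (EuclideanSpace.single 0 1) 2 + fderiv ℝ (v s) y (EuclideanSpace.single 2 1) 1 * fderiv ℝ (v s) y (EuclideanSpace.single 1 1) 2 + fderiv ℝ (v s) y (EuclideanSpace.single 2 1) 2 ^ 2 ≤ 0)) →
        ∀ y : EuclideanSpace ℝ (Fin 3), fderiv ℝ (v s) y (EuclideanSpace.single 2 1) 0 * fderiv ℝ (v s) y (EuclideanSpace.single 0 1) 2 + fderiv ℝ (v s) y (EuclideanSpace.single 2 1) 1 * fderiv ℝ (v s) y (EuclideanSpace.single 1 1) 2 + fderiv ℝ (v s) y (EuclideanSpace.single 2 1) 2 ^ 2 = 0 :=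
  Summit.NavierStokesRegularity.NavierStokesRegularity.Theorems.PoloidalWindowDoorPoloidalWindowRigidityPairingCollapse.stub_pairingCollapse

/-! ### Stub B1 (v2, price P9-3 of idea-crit-7 g3 16:17:59Z): the BALANCE DATUM — what T1's calculus gives on EVERY slice at EVERY centre, typed -/

/-- **STUB B1 (`stub_balanceDatum`) — PROVABLE (M; a corollary of T1's/R1's large-scale calculus, no sign hypothesis): for a class profile, poloidal
along `e₃`, there is `K' ≥ 0` such that on every slice `s < 0`, at every centre `c` and every scale `R > 0`, for every `C²` weight `χ` supported in
`B̄(c, 2R)` with `‖D²χ‖ ≤ R⁻²`, the three weighted masses of the NULL LAGRANGIANS — the pairing `Q₃ = ∂₂v₀∂₀v₂ + ∂₂v₁∂₁v₂ + (∂₂v₂)²`, the horizontal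
Jacobian `det ∇ₕvₕ = ∂₀v₀∂₁v₁ − ∂₁v₀∂₀v₁`, and `e = Σᵢⱼ ∂ⱼvᵢ∂ᵢvⱼ = tr((Dv)²)` (`= −Δp`) — are bounded by `K' R^(−1/2) (−s)^(−1/4)`.**
PROOF ROUTE: `Q₃ = ∂ᵢ∂ⱼB³ᵢⱼ(v)` (T1 (i)), `e = ∂ᵢ∂ⱼ(vᵢvⱼ)` (R1 (i), divergence-free), and `det ∇ₕvₕ = Q₃ − e/2` pointwise (for any 3×3 Jacobian with
`tr ∇ₕvₕ = −∂₂v₂`: `tr((∇ₕvₕ)²) = (∂₂v₂)² − 2 det ∇ₕvₕ`, so `e = 2Q₃ − 2 det ∇ₕvₕ`) `= ∂ᵢ∂ⱼ(B³ − ½ v⊗v)ᵢⱼ`; two integrations by parts against `χ`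
(compact support, smooth slice — no boundary terms): `|∫ χ·∂ᵢ∂ⱼBᵢⱼ| = |∫ Bᵢⱼ∂ᵢ∂ⱼχ| ≤ 9R⁻² ∫_(B̄(c,2R)) ‖v(s)‖²` (`|Bᵢⱼ| ≤ ‖v‖²`), and the class ENERGY
LEVEL `…LargeScaleEnergyBootstrapUniform.exists_uniform_level_of_gt_one` (α = 3/2; centre moved to `c` by the translation invariance of the class binders):
`∫_(B̄(c,2R)) ‖v(s)‖² ≤ K (2R)^(3/2) (−s)^(−1/4)`; `K' := 9·2^(3/2)·(3/2)K` covers all three.  USE: this is the quantitative statement the transonic residue T3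
now CARRIES as a hypothesis (v2) — subsonic and supersonic masses balance at all large scales, uniformly over centres; the entry datum for a wave-type
(`z_shock` characteristic families / `far_thread` disc moments) attack on T3.  [v3, ERRATUM E1 of critic idea-crit-7 g3 16:49:35Z, docstring only:] poloidality (`⟪curl v, e₃⟫ = 0`, kept in the binders) IS used for the `Q₃` and `det ∇ₕvₕ` clauses — T1 (i)'s double-divergence form of `Q₃` uses `ω₂ = 0` (without it `Q₃ = ∂ᵢ(v₂∂₂vᵢ)` is only a single divergence) and `det` inherits it through `det ∇ₕvₕ = Q₃ − e/2`; only the `e` clause is poloidality-free.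
Why it might fail: only formalisation (translation of the level to centre `c`; integrability/`C²` side conditions of the two integrations by parts; if an
integral is not Bochner-integrable its junk value `0` satisfies the bound trivially, so no `Integrable` binder is needed for truth). -/
theorem stub_balanceDatum :
    ∀ (C : ℝ) (v : ℝ → EuclideanSpace ℝ (Fin 3) → EuclideanSpace ℝ (Fin 3)),
      Literature.Analysis.FluidPDE.HasTypeITimeDecay C v →
      ContinuousOn (Function.uncurry v) (Set.Iio (0 : ℝ) ×ˢ Set.univ) →
      (∀ s t : ℝ, s < t → t < 0 → ∀ x, v t x =
        Literature.Analysis.UnboundedOperators.heatExtension (v s) (t - s) x -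
          Literature.Analysis.FluidPDE.oseenDuhamel 1 s v v t x) →
      (∀ t < 0, Literature.Analysis.FluidPDE.VectorCalculus.IsDivFree (v t)) →
      (∀ s < 0, ∀ y, ⟪Literature.Analysis.FluidPDE.curl (v s) y, EuclideanSpace.single 2 1⟫_ℝ = 0) →
      (∃ K' : ℝ, 0 ≤ K' ∧ ∀ s : ℝ, s < 0 → ∀ c : EuclideanSpace ℝ (Fin 3), ∀ R : ℝ, 0 < R →
          ∀ χ : EuclideanSpace ℝ (Fin 3) → ℝ, ContDiff ℝ 2 χ → (∀ y, 2 * R ≤ ‖y - c‖ → χ y = 0) →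
            (∀ y, ‖iteratedFDeriv ℝ 2 χ y‖ ≤ 1 / R ^ 2) →
            |∫ y, χ y * (fderiv ℝ (v s) y (EuclideanSpace.single 2 1) 0 * fderiv ℝ (v s) y (EuclideanSpace.single 0 1) 2 + fderiv ℝ (v s) y (EuclideanSpace.single 2 1) 1 * fderiv ℝ (v s) y (EuclideanSpace.single 1 1) 2 + fderiv ℝ (v s) y (EuclideanSpace.single 2 1) 2 ^ 2)| ≤ K' * R ^ (-(1 / 2 : ℝ)) * (-s) ^ (-(1 / 4 : ℝ)) ∧
            |∫ y, χ y * (fderiv ℝ (v s) y (EuclideanSpace.single 0 1) 0 * fderiv ℝ (v s) y (EuclideanSpace.single 1 1) 1 - fderiv ℝ (v s) y (EuclideanSpace.single 1 1) 0 * fderiv ℝ (v s) y (EuclideanSpace.single 0 1) 1)| ≤ K' * R ^ (-(1 / 2 : ℝ)) * (-s) ^ (-(1 / 4 : ℝ)) ∧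
            |∫ y, χ y * (∑ i : Fin 3, ∑ j : Fin 3, fderiv ℝ (v s) y (EuclideanSpace.single j 1) i * fderiv ℝ (v s) y (EuclideanSpace.single i 1) j)| ≤ K' * R ^ (-(1 / 2 : ℝ)) * (-s) ^ (-(1 / 4 : ℝ))) :=
  Summit.NavierStokesRegularity.NavierStokesRegularity.Theorems.PoloidalWindowDoorPoloidalWindowRigidityBalanceDatum.stub_balanceDatum

/-- **STUB T2 (`stub_selfCharacteristic`) — the SUBSONIC/SUPERSONIC-KEPT sub-cell is a SIMPLE WAVE and dies (research-grade, M/L; the deciding cut of this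
line, strictly inside `hHT`): a hyperbolic THICK twisting window whose time-slab `(a,b)` consists of PAIRING-NULL slices (`Q₃ ≡ 0`, supplied by T1) is not
backward-singular.**  WHY EASIER than `hHT`: on the slab the single scalar `w = v₂` satisfies TWO equations — `K1` (`w_zz + div_h(m∇_h w) = 0`, tree
`…VerticalConvexity` / THICK-NF `…ClebschPsiEquation`) AND the EIKONAL relation `w_z² + m|∇_h w|² = 0` — an overdetermined pair whose solutions are simple
waves (one Riemann invariant constant: the characteristic family is FIXED by the eikonal relation, which is exactly the entry datum the `z_shock` line has to
produce by itself); along the fixed family `w` is transported by a scalar first-order law in the height `z ∈ ℝ`, and genuine nonlinearity (`m_w ≠ 0`, forced by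
THICK: `m` is constant on the planar leaves `{w = c}` but not constant) breaks an entire-in-`z` smooth simple wave (gradient catastrophe forward or backward in
`z`), while linear degeneracy is the (TV)/(TH) case excluded by the not-(TV) clause resp. handled by `hH`.  ALTERNATIVE (machine) route: prolong
{K1, frozen law, eikonal, K2} at a window point to finite order — the overdetermined system should have EMPTY twisting-thick jet locus (a CERT job of the K2p5 kind).
Why it might fail: a thick, twisting, (M)-free self-characteristic local germ may exist (two horizontal dimensions leave room that 1+1-D simple-wave theory does
not see); then T2 needs (M) beyond the frozen law (K2/K3), and the breakdown argument needs the leafwise transport law written invariantly. -/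
theorem stub_selfCharacteristic :
    ∀ (C : ℝ) (v : ℝ → EuclideanSpace ℝ (Fin 3) → EuclideanSpace ℝ (Fin 3)),
      Literature.Analysis.FluidPDE.HasTypeITimeDecay C v →
      ContinuousOn (Function.uncurry v) (Set.Iio (0 : ℝ) ×ˢ Set.univ) →
      (∀ s t : ℝ, s < t → t < 0 → ∀ x, v t x =
        Literature.Analysis.UnboundedOperators.heatExtension (v s) (t - s) x -
          Literature.Analysis.FluidPDE.oseenDuhamel 1 s v v t x) →
      (∀ t < 0, Literature.Analysis.FluidPDE.VectorCalculus.IsDivFree (v t)) →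
      (∀ s < 0, ∀ y, ⟪Literature.Analysis.FluidPDE.curl (v s) y, EuclideanSpace.single 2 1⟫_ℝ = 0) →
      ∀ W : Set (ℝ × EuclideanSpace ℝ (Fin 3)), IsOpen W → W.Nonempty → W ⊆ Set.Iio (0 : ℝ) ×ˢ Set.univ →
        (∀ z ∈ W, Literature.Analysis.FluidPDE.curl (v z.1) z.2 ≠ 0 ∧
          (fderiv ℝ (v z.1) z.2 (EuclideanSpace.single 0 1) 2 ≠ 0 ∨ fderiv ℝ (v z.1) z.2 (EuclideanSpace.single 1 1) 2 ≠ 0) ∧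
          (fderiv ℝ (v z.1) z.2 (EuclideanSpace.single 2 1) 0 ≠ 0 ∨ fderiv ℝ (v z.1) z.2 (EuclideanSpace.single 2 1) 1 ≠ 0)) →
        (∀ m : ℝ → ℝ, ∀ W₁ : Set (ℝ × EuclideanSpace ℝ (Fin 3)), W₁ ⊆ W → IsOpen W₁ → W₁.Nonempty →
          ∃ z ∈ W₁, ∃ b : Fin 3, b ≠ 2 ∧
            fderiv ℝ (v z.1) z.2 (EuclideanSpace.single 2 1) b ≠
              m z.1 * fderiv ℝ (v z.1) z.2 (EuclideanSpace.single b 1) 2) →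
        (∀ z ∈ W,
          fderiv ℝ (fun x => fderiv ℝ (v z.1) x (EuclideanSpace.single 2 1) 2) z.2 (EuclideanSpace.single 0 1) *
              fderiv ℝ (v z.1) z.2 (EuclideanSpace.single 1 1) 2 -
            fderiv ℝ (fun x => fderiv ℝ (v z.1) x (EuclideanSpace.single 2 1) 2) z.2 (EuclideanSpace.single 1 1) *
              fderiv ℝ (v z.1) z.2 (EuclideanSpace.single 0 1) 2 ≠ 0) →
        (∀ z ∈ W,
          fderiv ℝ (v z.1) z.2 (EuclideanSpace.single 2 1) 0 * fderiv ℝ (v z.1) z.2 (EuclideanSpace.single 0 1) 2 +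
            fderiv ℝ (v z.1) z.2 (EuclideanSpace.single 2 1) 1 * fderiv ℝ (v z.1) z.2 (EuclideanSpace.single 1 1) 2 < 0) →
        (∀ m : ℝ → ℝ → ℝ, ∀ W₁ : Set (ℝ × EuclideanSpace ℝ (Fin 3)), W₁ ⊆ W → IsOpen W₁ → W₁.Nonempty →
          ∃ z ∈ W₁, ∃ b : Fin 3, b ≠ 2 ∧
            fderiv ℝ (v z.1) z.2 (EuclideanSpace.single 2 1) b ≠
              m z.1 (z.2 2) * fderiv ℝ (v z.1) z.2 (EuclideanSpace.single b 1) 2) →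
        ∀ a b : ℝ, b ≤ 0 → W ⊆ Set.Ioo a b ×ˢ Set.univ →
        (∀ s ∈ Set.Ioo a b, ∀ y : EuclideanSpace ℝ (Fin 3),
          fderiv ℝ (v s) y (EuclideanSpace.single 2 1) 0 * fderiv ℝ (v s) y (EuclideanSpace.single 0 1) 2 + fderiv ℝ (v s) y (EuclideanSpace.single 2 1) 1 * fderiv ℝ (v s) y (EuclideanSpace.single 1 1) 2 + fderiv ℝ (v s) y (EuclideanSpace.single 2 1) 2 ^ 2 = 0) →
        ¬ Literature.Analysis.FluidPDE.IsBackwardSingularPoint v 0 := by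
  sorry

/-- **STUB T3 (`stub_transonicThick`) — the RESIDUE (research-open; honest census: `hHT` minus the sign-kept slabs): a hyperbolic THICK twisting window
such that NO time-slab meeting it consists of sign-kept slices — i.e. TRANSONIC slices (a strict subsonic point `Q₃ > 0` AND a strict supersonic point
`Q₃ < 0` on the same slice) occur at a DENSE set of times near every window time — is not backward-singular.**  The hypothesis is stated as the literal
negation used by the dichotomy (`¬ ∃` slab …), so that the composition is pure logic.  v2 (P9-3): the residue now CARRIES the
BALANCE DATUM of stub B1 as a typed hypothesis (supplied by `stub_balanceDatum` in the composition): on every slice, at EVERY centre and scale,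
`|∫χ Q₃| , |∫χ det ∇ₕvₕ| , |∫χ e| ≤ K′R^{−1/2}(−s)^{−1/4}` for `C²` weights `χ` supported in `B̄(c,2R)` with `‖D²χ‖ ≤ R⁻²` — subsonic and supersonic
masses balance at all large scales; the quantitative entry datum for a wave-type (`z_shock` / `far_thread`) attack on the residue.
Why it might fail: it is the open core of the hyperbolic THICK column (`hyperbolicThick_false_without_mild`); no mechanism of this line reaches it. -/
theorem stub_transonicThick :
    ∀ (C : ℝ) (v : ℝ → EuclideanSpace ℝ (Fin 3) → EuclideanSpace ℝ (Fin 3)),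
      Literature.Analysis.FluidPDE.HasTypeITimeDecay C v →
      ContinuousOn (Function.uncurry v) (Set.Iio (0 : ℝ) ×ˢ Set.univ) →
      (∀ s t : ℝ, s < t → t < 0 → ∀ x, v t x =
        Literature.Analysis.UnboundedOperators.heatExtension (v s) (t - s) x -
          Literature.Analysis.FluidPDE.oseenDuhamel 1 s v v t x) →
      (∀ t < 0, Literature.Analysis.FluidPDE.VectorCalculus.IsDivFree (v t)) →
      (∀ s < 0, ∀ y, ⟪Literature.Analysis.FluidPDE.curl (v s) y, EuclideanSpace.single 2 1⟫_ℝ = 0) →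
      (∃ K' : ℝ, 0 ≤ K' ∧ ∀ s : ℝ, s < 0 → ∀ c : EuclideanSpace ℝ (Fin 3), ∀ R : ℝ, 0 < R →
          ∀ χ : EuclideanSpace ℝ (Fin 3) → ℝ, ContDiff ℝ 2 χ → (∀ y, 2 * R ≤ ‖y - c‖ → χ y = 0) →
            (∀ y, ‖iteratedFDeriv ℝ 2 χ y‖ ≤ 1 / R ^ 2) →
            |∫ y, χ y * (fderiv ℝ (v s) y (EuclideanSpace.single 2 1) 0 * fderiv ℝ (v s) y (EuclideanSpace.single 0 1) 2 + fderiv ℝ (v s) y (EuclideanSpace.single 2 1) 1 * fderiv ℝ (v s) y (EuclideanSpace.single 1 1) 2 + fderiv ℝ (v s) y (EuclideanSpace.single 2 1) 2 ^ 2)| ≤ K' * R ^ (-(1 / 2 : ℝ)) * (-s) ^ (-(1 / 4 : ℝ)) ∧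
            |∫ y, χ y * (fderiv ℝ (v s) y (EuclideanSpace.single 0 1) 0 * fderiv ℝ (v s) y (EuclideanSpace.single 1 1) 1 - fderiv ℝ (v s) y (EuclideanSpace.single 1 1) 0 * fderiv ℝ (v s) y (EuclideanSpace.single 0 1) 1)| ≤ K' * R ^ (-(1 / 2 : ℝ)) * (-s) ^ (-(1 / 4 : ℝ)) ∧
            |∫ y, χ y * (∑ i : Fin 3, ∑ j : Fin 3, fderiv ℝ (v s) y (EuclideanSpace.single j 1) i * fderiv ℝ (v s) y (EuclideanSpace.single i 1) j)| ≤ K' * R ^ (-(1 / 2 : ℝ)) * (-s) ^ (-(1 / 4 : ℝ))) →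
      ∀ W : Set (ℝ × EuclideanSpace ℝ (Fin 3)), IsOpen W → W.Nonempty → W ⊆ Set.Iio (0 : ℝ) ×ˢ Set.univ →
        (∀ z ∈ W, Literature.Analysis.FluidPDE.curl (v z.1) z.2 ≠ 0 ∧
          (fderiv ℝ (v z.1) z.2 (EuclideanSpace.single 0 1) 2 ≠ 0 ∨ fderiv ℝ (v z.1) z.2 (EuclideanSpace.single 1 1) 2 ≠ 0) ∧
          (fderiv ℝ (v z.1) z.2 (EuclideanSpace.single 2 1) 0 ≠ 0 ∨ fderiv ℝ (v z.1) z.2 (EuclideanSpace.single 2 1) 1 ≠ 0)) →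
        (∀ m : ℝ → ℝ, ∀ W₁ : Set (ℝ × EuclideanSpace ℝ (Fin 3)), W₁ ⊆ W → IsOpen W₁ → W₁.Nonempty →
          ∃ z ∈ W₁, ∃ b : Fin 3, b ≠ 2 ∧
            fderiv ℝ (v z.1) z.2 (EuclideanSpace.single 2 1) b ≠
              m z.1 * fderiv ℝ (v z.1) z.2 (EuclideanSpace.single b 1) 2) →
        (∀ z ∈ W,
          fderiv ℝ (fun x => fderiv ℝ (v z.1) x (EuclideanSpace.single 2 1) 2) z.2 (EuclideanSpace.single 0 1) *
              fderiv ℝ (v z.1) z.2 (EuclideanSpace.single 1 1) 2 -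
            fderiv ℝ (fun x => fderiv ℝ (v z.1) x (EuclideanSpace.single 2 1) 2) z.2 (EuclideanSpace.single 1 1) *
              fderiv ℝ (v z.1) z.2 (EuclideanSpace.single 0 1) 2 ≠ 0) →
        (∀ z ∈ W,
          fderiv ℝ (v z.1) z.2 (EuclideanSpace.single 2 1) 0 * fderiv ℝ (v z.1) z.2 (EuclideanSpace.single 0 1) 2 +
            fderiv ℝ (v z.1) z.2 (EuclideanSpace.single 2 1) 1 * fderiv ℝ (v z.1) z.2 (EuclideanSpace.single 1 1) 2 < 0) →
        (∀ m : ℝ → ℝ → ℝ, ∀ W₁ : Set (ℝ × EuclideanSpace ℝ (Fin 3)), W₁ ⊆ W → IsOpen W₁ → W₁.Nonempty →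
          ∃ z ∈ W₁, ∃ b : Fin 3, b ≠ 2 ∧
            fderiv ℝ (v z.1) z.2 (EuclideanSpace.single 2 1) b ≠
              m z.1 (z.2 2) * fderiv ℝ (v z.1) z.2 (EuclideanSpace.single b 1) 2) →
        (¬ (∃ a b : ℝ, b ≤ 0 ∧ (W ∩ (Set.Ioo a b ×ˢ Set.univ)).Nonempty ∧
          ∀ s ∈ Set.Ioo a b, ((∀ y : EuclideanSpace ℝ (Fin 3), 0 ≤ fderiv ℝ (v s) y (EuclideanSpace.single 2 1) 0 * fderiv ℝ (v s) y (EuclideanSpace.single 0 1) 2 + fderiv ℝ (v s) y (EuclideanSpace.single 2 1) 1 * fderiv ℝ (v s) y (EuclideanSpace.single 1 1) 2 + fderiv ℝ (v s) y (EuclideanSpace.single 2 1) 2 ^ 2) ∨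
          (∀ y : EuclideanSpace ℝ (Fin 3), fderiv ℝ (v s) y (EuclideanSpace.single 2 1) 0 * fderiv ℝ (v s) y (EuclideanSpace.single 0 1) 2 + fderiv ℝ (v s) y (EuclideanSpace.single 2 1) 1 * fderiv ℝ (v s) y (EuclideanSpace.single 1 1) 2 + fderiv ℝ (v s) y (EuclideanSpace.single 2 1) 2 ^ 2 ≤ 0)))) →
        ¬ Literature.Analysis.FluidPDE.IsBackwardSingularPoint v 0 := by
  sorry

/-! ### Composition, step 0 (proved): the shared stub `stub_hyperbolicThick` (`hHT`) from T1, T2, T3 — the SONIC CUT -/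

/-- **`stub_hyperbolicThick` (shared with `mixed_type` / `z_shock` / `strain_tube` / `riesz_collapse`, = `hHT` of `twisting_regular_of_three`) PROVED from
T1–T3**: either some time-slab `(a,b)`, `b ≤ 0`, meeting `W` consists of sign-kept slices — then by T1 they are pairing-null, the shrunk window
`W ∩ ((a,b) × ℝ³)` inherits every (hereditary) clause of `hHT`, and T2 applies — or no such slab exists, which is T3's hypothesis verbatim. -/
theorem hyperbolicThick_of_sonicCut :
    ∀ (C : ℝ) (v : ℝ → EuclideanSpace ℝ (Fin 3) → EuclideanSpace ℝ (Fin 3)),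
      Literature.Analysis.FluidPDE.HasTypeITimeDecay C v →
      ContinuousOn (Function.uncurry v) (Set.Iio (0 : ℝ) ×ˢ Set.univ) →
      (∀ s t : ℝ, s < t → t < 0 → ∀ x, v t x =
        Literature.Analysis.UnboundedOperators.heatExtension (v s) (t - s) x -
          Literature.Analysis.FluidPDE.oseenDuhamel 1 s v v t x) →
      (∀ t < 0, Literature.Analysis.FluidPDE.VectorCalculus.IsDivFree (v t)) →
      (∀ s < 0, ∀ y, ⟪Literature.Analysis.FluidPDE.curl (v s) y, EuclideanSpace.single 2 1⟫_ℝ = 0) →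
      ∀ W : Set (ℝ × EuclideanSpace ℝ (Fin 3)), IsOpen W → W.Nonempty → W ⊆ Set.Iio (0 : ℝ) ×ˢ Set.univ →
        (∀ z ∈ W, Literature.Analysis.FluidPDE.curl (v z.1) z.2 ≠ 0 ∧
          (fderiv ℝ (v z.1) z.2 (EuclideanSpace.single 0 1) 2 ≠ 0 ∨ fderiv ℝ (v z.1) z.2 (EuclideanSpace.single 1 1) 2 ≠ 0) ∧
          (fderiv ℝ (v z.1) z.2 (EuclideanSpace.single 2 1) 0 ≠ 0 ∨ fderiv ℝ (v z.1) z.2 (EuclideanSpace.single 2 1) 1 ≠ 0)) →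
        (∀ m : ℝ → ℝ, ∀ W₁ : Set (ℝ × EuclideanSpace ℝ (Fin 3)), W₁ ⊆ W → IsOpen W₁ → W₁.Nonempty →
          ∃ z ∈ W₁, ∃ b : Fin 3, b ≠ 2 ∧
            fderiv ℝ (v z.1) z.2 (EuclideanSpace.single 2 1) b ≠
              m z.1 * fderiv ℝ (v z.1) z.2 (EuclideanSpace.single b 1) 2) →
        (∀ z ∈ W,
          fderiv ℝ (fun x => fderiv ℝ (v z.1) x (EuclideanSpace.single 2 1) 2) z.2 (EuclideanSpace.single 0 1) *
              fderiv ℝ (v z.1) z.2 (EuclideanSpace.single 1 1) 2 -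
            fderiv ℝ (fun x => fderiv ℝ (v z.1) x (EuclideanSpace.single 2 1) 2) z.2 (EuclideanSpace.single 1 1) *
              fderiv ℝ (v z.1) z.2 (EuclideanSpace.single 0 1) 2 ≠ 0) →
        (∀ z ∈ W,
          fderiv ℝ (v z.1) z.2 (EuclideanSpace.single 2 1) 0 * fderiv ℝ (v z.1) z.2 (EuclideanSpace.single 0 1) 2 +
            fderiv ℝ (v z.1) z.2 (EuclideanSpace.single 2 1) 1 * fderiv ℝ (v z.1) z.2 (EuclideanSpace.single 1 1) 2 < 0) →
        (∀ m : ℝ → ℝ → ℝ, ∀ W₁ : Set (ℝ × EuclideanSpace ℝ (Fin 3)), W₁ ⊆ W → IsOpen W₁ → W₁.Nonempty →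
          ∃ z ∈ W₁, ∃ b : Fin 3, b ≠ 2 ∧
            fderiv ℝ (v z.1) z.2 (EuclideanSpace.single 2 1) b ≠
              m z.1 (z.2 2) * fderiv ℝ (v z.1) z.2 (EuclideanSpace.single b 1) 2) →
        ¬ Literature.Analysis.FluidPDE.IsBackwardSingularPoint v 0 := by
  intro C v hrate hcont hmild hdiv hpol W hW hWne hWs hnd hpin htw hhyp hth
  by_cases h : (∃ a b : ℝ, b ≤ 0 ∧ (W ∩ (Set.Ioo a b ×ˢ Set.univ)).Nonempty ∧
          ∀ s ∈ Set.Ioo a b, ((∀ y : EuclideanSpace ℝ (Fin 3), 0 ≤ fderiv ℝ (v s) y (EuclideanSpace.single 2 1) 0 * fderiv ℝ (v s) y (EuclideanSpace.single 0 1) 2 + fderiv ℝ (v s) y (EuclideanSpace.single 2 1) 1 * fderiv ℝ (v s) y (EuclideanSpace.single 1 1) 2 + fderiv ℝ (v s) y (EuclideanSpace.single 2 1) 2 ^ 2) ∨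
          (∀ y : EuclideanSpace ℝ (Fin 3), fderiv ℝ (v s) y (EuclideanSpace.single 2 1) 0 * fderiv ℝ (v s) y (EuclideanSpace.single 0 1) 2 + fderiv ℝ (v s) y (EuclideanSpace.single 2 1) 1 * fderiv ℝ (v s) y (EuclideanSpace.single 1 1) 2 + fderiv ℝ (v s) y (EuclideanSpace.single 2 1) 2 ^ 2 ≤ 0)))
  · obtain ⟨a, b, hb, hne, hsk⟩ := h
    have hnull : (∀ s ∈ Set.Ioo a b, ∀ y : EuclideanSpace ℝ (Fin 3),
          fderiv ℝ (v s) y (EuclideanSpace.single 2 1) 0 * fderiv ℝ (v s) y (EuclideanSpace.single 0 1) 2 + fderiv ℝ (v s) y (EuclideanSpace.single 2 1) 1 * fderiv ℝ (v s) y (EuclideanSpace.single 1 1) 2 + fderiv ℝ (v s) y (EuclideanSpace.single 2 1) 2 ^ 2 = 0) := fun s hs y =>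
      stub_pairingCollapse C v hrate hcont hmild hdiv hpol s (lt_of_lt_of_le hs.2 hb) (hsk s hs) y
    have hO : IsOpen (W ∩ (Set.Ioo a b ×ˢ (Set.univ : Set (EuclideanSpace ℝ (Fin 3))))) :=
      hW.inter (isOpen_Ioo.prod isOpen_univ)
    exact stub_selfCharacteristic C v hrate hcont hmild hdiv hpol (W ∩ (Set.Ioo a b ×ˢ Set.univ)) hO hne
      (fun z hz => hWs hz.1) (fun z hz => hnd z hz.1)
      (fun m W₁ hW₁ hW₁o hW₁ne => hpin m W₁ (fun z hz => (hW₁ hz).1) hW₁o hW₁ne)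
      (fun z hz => htw z hz.1) (fun z hz => hhyp z hz.1)
      (fun m W₁ hW₁ hW₁o hW₁ne => hth m W₁ (fun z hz => (hW₁ hz).1) hW₁o hW₁ne)
      a b hb (fun z hz => hz.2) hnull
  · exact stub_transonicThick C v hrate hcont hmild hdiv hpol (stub_balanceDatum C v hrate hcont hmild hdiv hpol)
      W hW hWne hWs hnd hpin htw hhyp hth h

/-! ### Shared stub R1 (VERBATIM with `Lines/riesz_collapse.lean`, ns-idea-8 g4 LINE 8): SEMI-ELLIPTIC SLICES ARE RIGID — gives the cell `hST` -/

/-- **STUB R1 (`stub_rieszCollapse`) — SHARED VERBATIM with `Lines/riesz_collapse.lean` (its lever; provable, M-sized): on a slice `s < 0` of a class profile, poloidal along `e₃`, with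
`I := ∂₂v₀∂₀v₂ + ∂₂v₁∂₁v₂ ≥ 0` EVERYWHERE on the slice, the three non-negative summands of `−Δp = |∇_h v_h|² + (∂₂v₂)² + 2I` vanish identically:
`(∂₀v₀)² + (∂₀v₁)² + (∂₁v₀)² + (∂₁v₁)² = 0`, `∂₂v₂ = 0`, `I = 0` at every point (`∂ⱼvᵢ = Dv(single j 1) i`).**
PROOF ROUTE (every ingredient is a tree theorem).  (i) The slice is real-analytic (`…TypeIAnalytic` / `…ClassRate`) and divergence-free; poloidality
(`ω₂ = 0 ⇔ ∂₀v₁ = ∂₁v₀`) makes `e := |∇_h v_h|² + (∂₂v₂)² + 2I = Σ_{i,j} ∂ⱼvᵢ ∂ᵢvⱼ = tr((Dv)²)`, and `tr((Dv)²) = ∂ᵢ∂ⱼ(vᵢvⱼ)` for divergence-free `C²` fields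
(`∂ᵢ∂ⱼ(vᵢvⱼ) = ∂ⱼvᵢ∂ᵢvⱼ + v·∇(div v)`; entrywise form in the tree: `…Equipartition.divergence_inner_smul_fderiv_apply`, `⟪Dv(Dv b),a⟫ = div(⟪v,a⟫∂_b v)`).
(ii) With the smooth cut-off `χ_R(y) = smoothTransition(2 − ‖y‖²/R²)` (`= 1` on `B̄_R`, support `B̄_{√2 R} ⊆ B̄_{2R}`, `‖D²χ_R‖ ≤ c/R²`:
`…EnstrophyHessianCollar.exists_norm_iteratedFDeriv_two_smoothTransition_cutoff_le`; gradient/Laplacian companions in `…LargeScaleEnergy`), two integrations by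
parts without boundary (`integral_mul_divergence_add_eq_zero_left`, then `…Equipartition.integral_mul_inner_fderiv_fderiv_eq`-style once more):
`∫ χ_R e(s) = ∫ Σ vᵢvⱼ ∂ᵢ∂ⱼχ_R ≤ (9c/R²) ∫_{B̄(0,2R)} ‖v(s)‖²`.  (iii) ENERGY LEVEL `…LargeScaleEnergyBootstrapUniform.exists_uniform_level_of_gt_one` with
`α = 3/2`: `∫_{B̄(0,2R)}‖v(s)‖² ≤ K (2R)^{3/2} (−s)^{−1/4}`, hence `0 ≤ ∫ χ_R e(s) ≤ 9cK2^{3/2} R^{−1/2} (−s)^{−1/4} → 0` (`R → ∞`).  (iv) `e ≥ 0` on the slice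
(squares + the binder `0 ≤ I`), so for `r ≤ R`: `0 ≤ ∫_{B_r} e(s) ≤ ∫ χ_R e(s)`; let `R → ∞`: `∫_{B_r} e(s) = 0` for every `r`, `e(s,·)` continuous and `≥ 0`
⇒ `e ≡ 0` ⇒ each summand `= 0`.  (M) consumed through the level: K-52's (M)-free `seField` is a sheet (`∫_{B_R}|V|² ≍ R³`) and violates the conclusion
(`I > 0` near `0`) — `semiEllipticThick_false_without_mild` honoured HERE.  The argument is sign-symmetric (`−Δp ≤ 0` everywhere ⇒ `e ≡ 0` as well).
Why it might fail: only the formalisation — Hessian-of-cut-off bookkeeping in `EuclideanSpace ℝ (Fin 3)` coordinates, the integrability side conditions of the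
two integrations by parts (compact support, `C²` slice), and `∫_{B_r} e = 0 ∧ e ≥ 0 continuous ⇒ e = 0` (`MeasureTheory.setIntegral_eq_zero_iff_of_nonneg`-type). -/
theorem stub_rieszCollapse :
    ∀ (C : ℝ) (v : ℝ → EuclideanSpace ℝ (Fin 3) → EuclideanSpace ℝ (Fin 3)),
      Literature.Analysis.FluidPDE.HasTypeITimeDecay C v →
      ContinuousOn (Function.uncurry v) (Set.Iio (0 : ℝ) ×ˢ Set.univ) →
      (∀ s t : ℝ, s < t → t < 0 → ∀ x, v t x =
        Literature.Analysis.UnboundedOperators.heatExtension (v s) (t - s) x -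
          Literature.Analysis.FluidPDE.oseenDuhamel 1 s v v t x) →
      (∀ t < 0, Literature.Analysis.FluidPDE.VectorCalculus.IsDivFree (v t)) →
      (∀ s < 0, ∀ y, ⟪Literature.Analysis.FluidPDE.curl (v s) y, EuclideanSpace.single 2 1⟫_ℝ = 0) →
      ∀ s : ℝ, s < 0 →
        (∀ y : EuclideanSpace ℝ (Fin 3),
          0 ≤ fderiv ℝ (v s) y (EuclideanSpace.single 2 1) 0 * fderiv ℝ (v s) y (EuclideanSpace.single 0 1) 2 +
                fderiv ℝ (v s) y (EuclideanSpace.single 2 1) 1 * fderiv ℝ (v s) y (EuclideanSpace.single 1 1) 2) →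
        ∀ y : EuclideanSpace ℝ (Fin 3),
          (fderiv ℝ (v s) y (EuclideanSpace.single 0 1) 0) ^ 2 + (fderiv ℝ (v s) y (EuclideanSpace.single 0 1) 1) ^ 2 +
              (fderiv ℝ (v s) y (EuclideanSpace.single 1 1) 0) ^ 2 + (fderiv ℝ (v s) y (EuclideanSpace.single 1 1) 1) ^ 2 = 0 ∧
            fderiv ℝ (v s) y (EuclideanSpace.single 2 1) 2 = 0 ∧
            fderiv ℝ (v s) y (EuclideanSpace.single 2 1) 0 * fderiv ℝ (v s) y (EuclideanSpace.single 0 1) 2 +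
                fderiv ℝ (v s) y (EuclideanSpace.single 2 1) 1 * fderiv ℝ (v s) y (EuclideanSpace.single 1 1) 2 = 0 :=
  Summit.NavierStokesRegularity.NavierStokesRegularity.Theorems.PoloidalWindowDoorPoloidalWindowRigidityRieszCollapse.stub_rieszCollapse

/-! ### Composition, step 1 (proved): the shared stub `stub_semiEllipticThick` (`hST`) from R1 ALONE — semi-elliptic slices do not twist -/

/-- **`stub_semiEllipticThick` (shared with `mixed_type` / `z_shock` / `far_thread` / `thread_axis` / `strain_tube`, = `hST` of `twisting_regular_of_three`)
PROVED from R1**: pick a point `z` of the (non-empty) window; its slice `z.1` lies in the semi-elliptic slab, so by R1 `∂₂v₂ ≡ 0` on that slice; then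
`x ↦ ∂₂v₂(z.1, x)` is the zero function, its derivative vanishes, and the twist clause `∂₀(∂₂v₂)·∂₁v₂ − ∂₁(∂₂v₂)·∂₀v₂ ≠ 0` at `z` is violated. -/
theorem semiEllipticThick_of_rieszCollapse :
    ∀ (C : ℝ) (v : ℝ → EuclideanSpace ℝ (Fin 3) → EuclideanSpace ℝ (Fin 3)),
      Literature.Analysis.FluidPDE.HasTypeITimeDecay C v →
      ContinuousOn (Function.uncurry v) (Set.Iio (0 : ℝ) ×ˢ Set.univ) →
      (∀ s t : ℝ, s < t → t < 0 → ∀ x, v t x =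
        Literature.Analysis.UnboundedOperators.heatExtension (v s) (t - s) x -
          Literature.Analysis.FluidPDE.oseenDuhamel 1 s v v t x) →
      (∀ t < 0, Literature.Analysis.FluidPDE.VectorCalculus.IsDivFree (v t)) →
      (∀ s < 0, ∀ y, ⟪Literature.Analysis.FluidPDE.curl (v s) y, EuclideanSpace.single 2 1⟫_ℝ = 0) →
      ∀ W : Set (ℝ × EuclideanSpace ℝ (Fin 3)), IsOpen W → W.Nonempty → W ⊆ Set.Iio (0 : ℝ) ×ˢ Set.univ →
        (∀ z ∈ W, Literature.Analysis.FluidPDE.curl (v z.1) z.2 ≠ 0 ∧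
          (fderiv ℝ (v z.1) z.2 (EuclideanSpace.single 0 1) 2 ≠ 0 ∨ fderiv ℝ (v z.1) z.2 (EuclideanSpace.single 1 1) 2 ≠ 0) ∧
          (fderiv ℝ (v z.1) z.2 (EuclideanSpace.single 2 1) 0 ≠ 0 ∨ fderiv ℝ (v z.1) z.2 (EuclideanSpace.single 2 1) 1 ≠ 0)) →
        (∀ m : ℝ → ℝ, ∀ W₁ : Set (ℝ × EuclideanSpace ℝ (Fin 3)), W₁ ⊆ W → IsOpen W₁ → W₁.Nonempty →
          ∃ z ∈ W₁, ∃ b : Fin 3, b ≠ 2 ∧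
            fderiv ℝ (v z.1) z.2 (EuclideanSpace.single 2 1) b ≠
              m z.1 * fderiv ℝ (v z.1) z.2 (EuclideanSpace.single b 1) 2) →
        (∀ z ∈ W,
          fderiv ℝ (fun x => fderiv ℝ (v z.1) x (EuclideanSpace.single 2 1) 2) z.2 (EuclideanSpace.single 0 1) *
              fderiv ℝ (v z.1) z.2 (EuclideanSpace.single 1 1) 2 -
            fderiv ℝ (fun x => fderiv ℝ (v z.1) x (EuclideanSpace.single 2 1) 2) z.2 (EuclideanSpace.single 1 1) *
              fderiv ℝ (v z.1) z.2 (EuclideanSpace.single 0 1) 2 ≠ 0) →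
        ∀ a b : ℝ, W ⊆ Set.Ioo a b ×ˢ Set.univ →
          (∀ s ∈ Set.Ioo a b, ∀ y : EuclideanSpace ℝ (Fin 3),
            0 ≤ fderiv ℝ (v s) y (EuclideanSpace.single 2 1) 0 * fderiv ℝ (v s) y (EuclideanSpace.single 0 1) 2 +
                fderiv ℝ (v s) y (EuclideanSpace.single 2 1) 1 * fderiv ℝ (v s) y (EuclideanSpace.single 1 1) 2) →
          (∀ m : ℝ → ℝ → ℝ, ∀ W₁ : Set (ℝ × EuclideanSpace ℝ (Fin 3)), W₁ ⊆ W → IsOpen W₁ → W₁.Nonempty →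
          ∃ z ∈ W₁, ∃ b : Fin 3, b ≠ 2 ∧
            fderiv ℝ (v z.1) z.2 (EuclideanSpace.single 2 1) b ≠
              m z.1 (z.2 2) * fderiv ℝ (v z.1) z.2 (EuclideanSpace.single b 1) 2) →
          ¬ Literature.Analysis.FluidPDE.IsBackwardSingularPoint v 0 := by
  intro C v hrate hcont hmild hdiv hpol W hW hWne hWs hnd hpin htw a b hWab hsemi hth
  obtain ⟨z, hz⟩ := hWne
  have hz1 : z.1 ∈ Set.Ioo a b := (Set.mem_prod.1 (hWab hz)).1
  have hs0 : z.1 < 0 := by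
    have h := (Set.mem_prod.1 (hWs hz)).1
    simpa using h
  have hsemiz : ∀ y : EuclideanSpace ℝ (Fin 3),
      0 ≤ fderiv ℝ (v z.1) y (EuclideanSpace.single 2 1) 0 * fderiv ℝ (v z.1) y (EuclideanSpace.single 0 1) 2 +
          fderiv ℝ (v z.1) y (EuclideanSpace.single 2 1) 1 * fderiv ℝ (v z.1) y (EuclideanSpace.single 1 1) 2 :=
    fun y => hsemi z.1 hz1 y
  have hR := stub_rieszCollapse C v hrate hcont hmild hdiv hpol z.1 hs0 hsemiz
  have hwz : (fun x => fderiv ℝ (v z.1) x (EuclideanSpace.single 2 1) 2) = fun _ => (0 : ℝ) :=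
    funext fun x => (hR x).2.1
  have hzero : fderiv ℝ (fun x => fderiv ℝ (v z.1) x (EuclideanSpace.single 2 1) 2) z.2 (EuclideanSpace.single 0 1) *
        fderiv ℝ (v z.1) z.2 (EuclideanSpace.single 1 1) 2 -
      fderiv ℝ (fun x => fderiv ℝ (v z.1) x (EuclideanSpace.single 2 1) 2) z.2 (EuclideanSpace.single 1 1) *
        fderiv ℝ (v z.1) z.2 (EuclideanSpace.single 0 1) 2 = 0 := by
    rw [hwz]
    simp
  exact absurd hzero (htw z hz)

/-! ### Composition, step 2 (proved): `stub_twisting`, then the crux (= `mixed_type` v2 / `string_shells` v2 chain) -/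

/-- **NON-DEGENERATE + PIN + TWISTING ⇒ regular** — VERBATIM the statement of the registered stub `stub_twisting` of
`Lines/lrc_jet.lean` v5 (= `mixed_type`'s `twisting_of_mixedType`), PROVED: `hH` from the shared (TH) stub `stub_hyperbolicTH`, `hHT` from `hyperbolicThick_of_sonicCut` (THIS LINE), `hST` from `semiEllipticThick_of_rieszCollapse` (shared R1, line riesz_collapse). -/
theorem twisting_of_sonicCut :
    ∀ (C : ℝ) (v : ℝ → EuclideanSpace ℝ (Fin 3) → EuclideanSpace ℝ (Fin 3)),
      Literature.Analysis.FluidPDE.HasTypeITimeDecay C v →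
      ContinuousOn (Function.uncurry v) (Set.Iio (0 : ℝ) ×ˢ Set.univ) →
      (∀ s t : ℝ, s < t → t < 0 → ∀ x, v t x =
        Literature.Analysis.UnboundedOperators.heatExtension (v s) (t - s) x -
          Literature.Analysis.FluidPDE.oseenDuhamel 1 s v v t x) →
      (∀ t < 0, Literature.Analysis.FluidPDE.VectorCalculus.IsDivFree (v t)) →
      (∀ s < 0, ∀ y, ⟪Literature.Analysis.FluidPDE.curl (v s) y, EuclideanSpace.single 2 1⟫_ℝ = 0) →
      ∀ W : Set (ℝ × EuclideanSpace ℝ (Fin 3)), IsOpen W → W.Nonempty → W ⊆ Set.Iio (0 : ℝ) ×ˢ Set.univ →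
        (∀ z ∈ W, Literature.Analysis.FluidPDE.curl (v z.1) z.2 ≠ 0 ∧
          (fderiv ℝ (v z.1) z.2 (EuclideanSpace.single 0 1) 2 ≠ 0 ∨ fderiv ℝ (v z.1) z.2 (EuclideanSpace.single 1 1) 2 ≠ 0) ∧
          (fderiv ℝ (v z.1) z.2 (EuclideanSpace.single 2 1) 0 ≠ 0 ∨ fderiv ℝ (v z.1) z.2 (EuclideanSpace.single 2 1) 1 ≠ 0)) →
        (∀ m : ℝ → ℝ, ∀ W₁ : Set (ℝ × EuclideanSpace ℝ (Fin 3)), W₁ ⊆ W → IsOpen W₁ → W₁.Nonempty →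
          ∃ z ∈ W₁, ∃ b : Fin 3, b ≠ 2 ∧
            fderiv ℝ (v z.1) z.2 (EuclideanSpace.single 2 1) b ≠
              m z.1 * fderiv ℝ (v z.1) z.2 (EuclideanSpace.single b 1) 2) →
        (∀ z ∈ W,
          fderiv ℝ (fun x => fderiv ℝ (v z.1) x (EuclideanSpace.single 2 1) 2) z.2 (EuclideanSpace.single 0 1) *
              fderiv ℝ (v z.1) z.2 (EuclideanSpace.single 1 1) 2 -
            fderiv ℝ (fun x => fderiv ℝ (v z.1) x (EuclideanSpace.single 2 1) 2) z.2 (EuclideanSpace.single 1 1) *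
              fderiv ℝ (v z.1) z.2 (EuclideanSpace.single 0 1) 2 ≠ 0) →
        ¬ Literature.Analysis.FluidPDE.IsBackwardSingularPoint v 0 := by
  intro C v hrate hcont hmild hdiv hpol W hW hWne hWs hnd hpin htw
  refine twisting_regular_of_three C v hrate hcont hmild hdiv ?_ ?_ ?_ W hW hWne hWs hnd hpin htw
  · -- hH : hyperbolic (TH) windows
    intro W' hW' hW'ne hW's hnd' hpin' htw' hhyp' hTH'
    exact stub_hyperbolicTH C v hrate hcont hmild hdiv hpol W' hW' hW'ne hW's hnd' hpin' htw' hhyp' hTH'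
  · -- hHT : hyperbolic thick windows — THIS LINE (sonic cut: T1, T2, T3)
    intro W' hW' hW'ne hW's hnd' hpin' htw' hhyp' hth'
    exact hyperbolicThick_of_sonicCut C v hrate hcont hmild hdiv hpol W' hW' hW'ne hW's hnd' hpin' htw' hhyp' hth'
  · -- hST : twisting thick windows inside a semi-elliptic slab (shared R1 ⇒ hST, as in riesz_collapse)
    intro W' hW' hW'ne hW's hnd' hpin' htw' a b hWab hsemi hth'
    exact semiEllipticThick_of_rieszCollapse C v hrate hcont hmild hdiv hpol W' hW' hW'ne hW's hnd' hpin' htw' a b hWab hsemi hth'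

/-! ### Composition, step 2 (proved, = `mixed_type` v2 / `lrc_jet` v5 chain): the crux -/

/-- **NON-DEGENERATE + PIN ⇒ regular** — the pointwise twist dichotomy over the tree theorem `…StubUntwisted.stub_untwisted`
(p561151, the untwisted half) and `twisting_of_sonicCut` (the twisting half). -/
theorem ndRegular :
    ∀ (C : ℝ) (v : ℝ → EuclideanSpace ℝ (Fin 3) → EuclideanSpace ℝ (Fin 3)),
      Literature.Analysis.FluidPDE.HasTypeITimeDecay C v →
      ContinuousOn (Function.uncurry v) (Set.Iio (0 : ℝ) ×ˢ Set.univ) →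
      (∀ s t : ℝ, s < t → t < 0 → ∀ x, v t x =
        Literature.Analysis.UnboundedOperators.heatExtension (v s) (t - s) x -
          Literature.Analysis.FluidPDE.oseenDuhamel 1 s v v t x) →
      (∀ t < 0, Literature.Analysis.FluidPDE.VectorCalculus.IsDivFree (v t)) →
      (∀ s < 0, ∀ y, ⟪Literature.Analysis.FluidPDE.curl (v s) y, EuclideanSpace.single 2 1⟫_ℝ = 0) →
      ∀ W : Set (ℝ × EuclideanSpace ℝ (Fin 3)), IsOpen W → W.Nonempty → W ⊆ Set.Iio (0 : ℝ) ×ˢ Set.univ →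
        (∀ z ∈ W, Literature.Analysis.FluidPDE.curl (v z.1) z.2 ≠ 0 ∧
          (fderiv ℝ (v z.1) z.2 (EuclideanSpace.single 0 1) 2 ≠ 0 ∨ fderiv ℝ (v z.1) z.2 (EuclideanSpace.single 1 1) 2 ≠ 0) ∧
          (fderiv ℝ (v z.1) z.2 (EuclideanSpace.single 2 1) 0 ≠ 0 ∨ fderiv ℝ (v z.1) z.2 (EuclideanSpace.single 2 1) 1 ≠ 0)) →
        (∀ m : ℝ → ℝ, ∀ W₁ : Set (ℝ × EuclideanSpace ℝ (Fin 3)), W₁ ⊆ W → IsOpen W₁ → W₁.Nonempty →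
          ∃ z ∈ W₁, ∃ b : Fin 3, b ≠ 2 ∧
            fderiv ℝ (v z.1) z.2 (EuclideanSpace.single 2 1) b ≠
              m z.1 * fderiv ℝ (v z.1) z.2 (EuclideanSpace.single b 1) 2) →
        ¬ Literature.Analysis.FluidPDE.IsBackwardSingularPoint v 0 := by
  intro C v hrate hcont hmild hdiv hpol W hW hWne hWs hnd hpin
  set T : ℝ × EuclideanSpace ℝ (Fin 3) → ℝ := fun z =>
    fderiv ℝ (fun x => fderiv ℝ (v z.1) x (EuclideanSpace.single 2 1) 2) z.2 (EuclideanSpace.single 0 1) *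
              fderiv ℝ (v z.1) z.2 (EuclideanSpace.single 1 1) 2 -
            fderiv ℝ (fun x => fderiv ℝ (v z.1) x (EuclideanSpace.single 2 1) 2) z.2 (EuclideanSpace.single 1 1) *
              fderiv ℝ (v z.1) z.2 (EuclideanSpace.single 0 1) 2 with hT
  by_cases htw : ∃ z ∈ W, T z ≠ 0
  · obtain ⟨z₀, hz₀W, hz₀⟩ := htw
    have hslab : IsOpen (Set.Iio (0 : ℝ) ×ˢ (Set.univ : Set (EuclideanSpace ℝ (Fin 3)))) :=
      isOpen_Iio.prod isOpen_univ
    have hTc : ContinuousOn T (Set.Iio (0 : ℝ) ×ˢ Set.univ) := by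
      rw [hT]
      exact continuousOn_twist hrate hcont hmild
    have hO : IsOpen ((Set.Iio (0 : ℝ) ×ˢ Set.univ) ∩ T ⁻¹' {0}ᶜ) :=
      hTc.isOpen_inter_preimage hslab isOpen_compl_singleton
    set W₃ : Set (ℝ × EuclideanSpace ℝ (Fin 3)) := W ∩ ((Set.Iio (0 : ℝ) ×ˢ Set.univ) ∩ T ⁻¹' {0}ᶜ) with hW₃
    have hW₃o : IsOpen W₃ := hW.inter hO
    have hW₃W : W₃ ⊆ W := Set.inter_subset_left
    have hW₃ne : W₃.Nonempty := ⟨z₀, hz₀W, hWs hz₀W, hz₀⟩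
    refine twisting_of_sonicCut C v hrate hcont hmild hdiv hpol W₃ hW₃o hW₃ne (hW₃W.trans hWs)
      (fun z hz => hnd z (hW₃W hz)) (fun m W₁ hW₁ hW₁o hW₁ne => hpin m W₁ (hW₁.trans hW₃W) hW₁o hW₁ne) ?_
    intro z hz
    exact hz.2.2
  · push Not at htw
    exact Summit.NavierStokesRegularity.NavierStokesRegularity.Theorems.PoloidalWindowDoorPoloidalWindowRigidityStubUntwisted.stub_untwisted
      C v hrate hcont hmild hdiv hpol W hW hWne hWs hnd htw

/-- **LRC″ with spatial pins, UNDER THE SINGULARITY ASSUMPTION** (vacuously, from `ndRegular`) — the hypothesis `hLRC` of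
`…K2OfLrcSpatial.nonflatLiouville_of_lrc_spatial`. -/
theorem lrcSpatial_of_stubs :
    ∀ (C : ℝ) (v : ℝ → EuclideanSpace ℝ (Fin 3) → EuclideanSpace ℝ (Fin 3)),
      Literature.Analysis.FluidPDE.HasTypeITimeDecay C v →
      ContinuousOn (Function.uncurry v) (Set.Iio (0 : ℝ) ×ˢ Set.univ) →
      (∀ s t : ℝ, s < t → t < 0 → ∀ x, v t x =
        Literature.Analysis.UnboundedOperators.heatExtension (v s) (t - s) x -
          Literature.Analysis.FluidPDE.oseenDuhamel 1 s v v t x) →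
      (∀ t < 0, Literature.Analysis.FluidPDE.VectorCalculus.IsDivFree (v t)) →
      (∀ s < 0, ∀ y, ⟪Literature.Analysis.FluidPDE.curl (v s) y, EuclideanSpace.single 2 1⟫_ℝ = 0) →
      Literature.Analysis.FluidPDE.IsBackwardSingularPoint v 0 →
      ∀ W : Set (ℝ × EuclideanSpace ℝ (Fin 3)), IsOpen W → W.Nonempty → W ⊆ Set.Iio (0 : ℝ) ×ˢ Set.univ →
        (∀ z ∈ W, Literature.Analysis.FluidPDE.curl (v z.1) z.2 ≠ 0 ∧
          (fderiv ℝ (v z.1) z.2 (EuclideanSpace.single 0 1) 2 ≠ 0 ∨ fderiv ℝ (v z.1) z.2 (EuclideanSpace.single 1 1) 2 ≠ 0) ∧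
          (fderiv ℝ (v z.1) z.2 (EuclideanSpace.single 2 1) 0 ≠ 0 ∨ fderiv ℝ (v z.1) z.2 (EuclideanSpace.single 2 1) 1 ≠ 0)) →
        (∀ m : ℝ → ℝ, ∀ W₁ : Set (ℝ × EuclideanSpace ℝ (Fin 3)), W₁ ⊆ W → IsOpen W₁ → W₁.Nonempty →
          ∃ z ∈ W₁, ∃ b : Fin 3, b ≠ 2 ∧
            fderiv ℝ (v z.1) z.2 (EuclideanSpace.single 2 1) b ≠
              m z.1 * fderiv ℝ (v z.1) z.2 (EuclideanSpace.single b 1) 2) →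
        ∃ s : ℝ, s < 0 ∧ ∃ U : Set (EuclideanSpace ℝ (Fin 3)), IsOpen U ∧ U.Nonempty ∧
          ((∃ e : EuclideanSpace ℝ (Fin 3), e ≠ 0 ∧ ∀ y ∈ U, fderiv ℝ (Literature.Analysis.FluidPDE.curl (v s)) y e = 0) ∨
           (∃ c : EuclideanSpace ℝ (Fin 3), ∀ y ∈ U,
              Literature.Analysis.FluidPDE.rotGen (Literature.Analysis.FluidPDE.curl (v s) y) =
                fderiv ℝ (Literature.Analysis.FluidPDE.curl (v s)) y (Literature.Analysis.FluidPDE.rotGen (y - c)))) := by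
  intro C v hrate hcont hmild hdiv hpol hsing W hW hWne hWs hnd hpin
  exact absurd hsing (ndRegular C v hrate hcont hmild hdiv hpol W hW hWne hWs hnd hpin)

/-- **(TV) — both halves are tree theorems** (`…TimeShearLiminf.stub_tvLiminf`, p525351, and
`…HorizontalFlatPast.nonflatLiouville_of_timeShear_unbounded`): the hypothesis `hTV` of
`…K2OfLrcSpatial.nonflatLiouville_of_lrc_spatial`. -/
theorem tv_of_stubs :
    ∀ (C : ℝ) (v : ℝ → EuclideanSpace ℝ (Fin 3) → EuclideanSpace ℝ (Fin 3)),
      Literature.Analysis.FluidPDE.HasTypeITimeDecay C v →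
      ContinuousOn (Function.uncurry v) (Set.Iio (0 : ℝ) ×ˢ Set.univ) →
      (∀ s t : ℝ, s < t → t < 0 → ∀ x, v t x =
        Literature.Analysis.UnboundedOperators.heatExtension (v s) (t - s) x -
          Literature.Analysis.FluidPDE.oseenDuhamel 1 s v v t x) →
      (∀ t < 0, Literature.Analysis.FluidPDE.VectorCalculus.IsDivFree (v t)) →
      (∀ s < 0, ∀ y, ⟪Literature.Analysis.FluidPDE.curl (v s) y, EuclideanSpace.single 2 1⟫_ℝ = 0) →
      ∀ μ : ℝ → ℝ, (∀ s < 0, μ s < 0) → (∀ s < 0, AnalyticAt ℝ μ s) →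
        (∃ s₁ s₂ : ℝ, s₁ < 0 ∧ s₂ < 0 ∧ μ s₁ ≠ μ s₂) →
        (∀ s < 0, ∀ y, ∀ b : Fin 3, b ≠ 2 →
          fderiv ℝ (v s) y (EuclideanSpace.single 2 1) b = μ s * fderiv ℝ (v s) y (EuclideanSpace.single b 1) 2) →
        ¬ Literature.Analysis.FluidPDE.IsBackwardSingularPoint v 0 := by
  intro C v hrate hcont hmild hdiv hpol μ hneg han hnc hslope
  by_cases hB : ∃ M : ℝ, ∀ T : ℝ, ∃ τ < T, -M ≤ μ τ
  · exact Summit.NavierStokesRegularity.NavierStokesRegularity.Theorems.PoloidalWindowDoorPoloidalWindowRigidityTimeShearLiminf.stub_tvLiminf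
      C v hrate hcont hmild hdiv hpol μ hneg han hnc hslope hB
  · push Not at hB
    refine nonflatLiouville_of_timeShear_unbounded hrate hcont hmild hdiv hpol hslope fun M => ?_
    obtain ⟨T, hT⟩ := hB M
    refine ⟨T, fun τ hτ => ?_⟩
    have h1 : μ τ < -M := hT τ hτ
    have h2 : M < -μ τ := by linarith
    exact h2.le.trans (neg_le_abs (μ τ))

/-- **The slice-sharp residue from the stubs** (symmetry/genericity hypotheses unused): class + poloidal ⇒ not backward-singular,
by contradiction through `…K2OfLrcSpatial.nonflatLiouville_of_lrc_spatial`. -/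
theorem sliceSharpNonflatLiouville_of_sonicCut :
    ∀ (C : ℝ) (v : ℝ → EuclideanSpace ℝ (Fin 3) → EuclideanSpace ℝ (Fin 3)),
      Literature.Analysis.FluidPDE.HasTypeITimeDecay C v →
      ContinuousOn (Function.uncurry v) (Set.Iio (0 : ℝ) ×ˢ Set.univ) →
      (∀ s t : ℝ, s < t → t < 0 → ∀ x, v t x =
        Literature.Analysis.UnboundedOperators.heatExtension (v s) (t - s) x -
          Literature.Analysis.FluidPDE.oseenDuhamel 1 s v v t x) →
      (∀ t < 0, Literature.Analysis.FluidPDE.VectorCalculus.IsDivFree (v t)) →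
      (∀ s < 0, ∀ y, ⟪Literature.Analysis.FluidPDE.curl (v s) y, EuclideanSpace.single 2 1⟫_ℝ = 0) →
      (∀ s < 0, ∀ y, ⟪fderiv ℝ (v s) y (Literature.Analysis.FluidPDE.curl (v s) y), EuclideanSpace.single 2 1⟫_ℝ = 0) →
      (∀ s < 0, ∀ b : EuclideanSpace ℝ (Fin 3), b ≠ 0 → ∃ y,
        Literature.Analysis.FluidPDE.cross (Literature.Analysis.FluidPDE.curl (v s) y) b ≠ 0) →
      (∀ s < 0, ∃ y, fderiv ℝ (v s) y (EuclideanSpace.single 2 1) 0 ≠ 0 ∨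
        fderiv ℝ (v s) y (EuclideanSpace.single 2 1) 1 ≠ 0) →
      (∀ s < 0, ∀ a : EuclideanSpace ℝ (Fin 3), a ≠ 0 → ⟪a, EuclideanSpace.single 2 1⟫_ℝ = 0 →
        ∃ y, ⟪fderiv ℝ (v s) y a, EuclideanSpace.single 2 1⟫_ℝ ≠ 0) →
      (∀ s < 0, ∀ e : EuclideanSpace ℝ (Fin 3), e ≠ 0 → ∃ (y : EuclideanSpace ℝ (Fin 3)) (l : ℝ), v s (y + l • e) ≠ v s y) →
      (∀ s < 0, ∀ (L : EuclideanSpace ℝ (Fin 3) ≃ₗᵢ[ℝ] EuclideanSpace ℝ (Fin 3)) (c : EuclideanSpace ℝ (Fin 3)),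
        ¬ Literature.Analysis.FluidPDE.IsAxisymmetric (fun y => L.symm (v s (L y + c)))) →
      (∃ lam : ℝ, 0 < lam ∧ ∃ s < 0, ∃ y, lam • v (lam ^ 2 * s) (lam • y) ≠ v s y) →
        ¬ Literature.Analysis.FluidPDE.IsBackwardSingularPoint v 0 := by
  intro C v hrate hcont hmild hdiv hpol _ _ _ _ _ _ _ hsing
  exact nonflatLiouville_of_lrc_spatial hrate hcont hmild hdiv hpol
    (lrcSpatial_of_stubs C v hrate hcont hmild hdiv hpol hsing) (tv_of_stubs C v hrate hcont hmild hdiv hpol) hsing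

/-- **COMPOSITION (proved): the crux `PoloidalWindowRigidity` BY NAME** from this line's stubs T1 `stub_pairingCollapse` (provable: pairing-null
collapse), T2 `stub_selfCharacteristic` (the sign-kept sub-cell = simple waves), T3 `stub_transonicThick` (the residue), the shared R1 `stub_rieszCollapse`
(riesz_collapse: gives `hST`) and the shared `stub_hyperbolicTH` ((TH) column: string_shells / entire_slices), via the landed reduction
`…Sharper.poloidalWindowRigidity_of_sliceSharpNonflatLiouville`.  No summit is proved: six `sorry`s (v2), all inside `stub_*`. -/
theorem PoloidalWindowRigidity_of_sonicCut :
    Summit.NavierStokesRegularity.NavierStokesRegularity.Theses.PoloidalWindowDoor.PoloidalWindowRigidity :=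
  poloidalWindowRigidity_of_sliceSharpNonflatLiouville sliceSharpNonflatLiouville_of_sonicCut

end Summit.NavierStokesRegularity.NavierStokesRegularity.Cruxes.PoloidalWindowRigidity.SonicCut
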